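import Mathlib
import Literature.NumberTheory.ComplexMultiplication.SexticCMTypesB3Abstract
import Literature.NumberTheory.ComplexMultiplication.EmbeddingActionFaithful
import HarnessLib

/-!
# Sextic CM fields with Galois closure of degree 24 or 48: every CM type is primitive, no quadratic subfield

Field-theoretic form of `SexticCMTypesB3Abstract.lean`, in the setting of `EmbeddingAction.lean`: `K` a number
field with `[K:ℚ] = 6`, `L` a normal closure of `K` with `[L:ℚ] ∈ {24, 48}`, `Gal(L/ℚ) = L ≃ₐ[ℚ] L` acting on
`Hom_ℚ(K, L) = K →ₐ[ℚ] L` by `σ • φ = σ ∘ φ` (scoped `algEquivCompAction`; faithful by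
`faithfulSMul_algEquiv_algHom`, `|Hom_ℚ(K, L)| = 6` by `card_algHom_eq_finrank`), `c ∈ Gal(L/ℚ)` a central
involution moving every embedding, a CM type `Φ ∋ ψ₀` = a finset of embeddings with `φ ∈ Φ ↔ c ∘ φ ∉ Φ`.

* **`isPrimitive_of_sextic`** — `(Φ, ψ₀)` is primitive (`IsPrimitive (L ≃ₐ[ℚ] L) ↑Φ ψ₀`); hence
  **`stabilizer_reflexLift_eq_fixingSubgroup_of_sextic`** (`H' = Stab(reflex lift) = Gal(L/ψ₀K) = H`) and
  **`fixedField_stabilizer_reflexLift_eq_of_sextic`** (the reflex field of the reflex type is `ψ₀(K)`: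
  "`Kʳʳ = K`");
* **`no_quadratic_subfield_of_sextic`** — no intermediate field `E ⊆ ψ₀(K)` has `[E:ℚ] = 2`;
  `card_fixingSubgroup_of_sextic` — `|Gal(L/ψ₀K)| ∈ {4, 8}`;
* the hypothesis-free CM forms **`isPrimitive_of_sextic_cm`**, `fixedField_stabilizer_reflexLift_eq_of_sextic_cm`,
  `no_quadratic_subfield_of_sextic_cm` for `L` a CM field and `K` totally complex, with `c := conjGal` (its
  centrality, `c² = 1` and fixed-point-freeness are the theorems of `EmbeddingActionFaithful.lean`).

In Dodson's classification (1984, §5.1.2, `n = 3`) these are exactly the sextic CM fields whose Galois group is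
`(ℤ/2)³ ⋊ ℤ/3` or `(ℤ/2)³ ⋊ 𝔖₃`, i.e. which contain no imaginary quadratic field, and all `2³ = 8` of their CM
types are primitive (§5.1.3 Prop. 1).

## References

* B. Dodson, Trans. AMS 283 (1984) 1–32 [Dodson1984], §1.1, §5.1.2 Theorem, §5.1.3 Prop. 1 (p. 20).
* G. Shimura, *Abelian varieties with complex multiplication and modular functions* (1998) [Shimura1998], §8.2
  Prop. 26; M. Streng, *Complex multiplication of abelian surfaces* (2010) [Streng2010], Ch. I Lemma 7.2.

## Provenance

Staged by the pub-hodgecm formalisation cell (DAG-node prover #01 lineage) under the LEAN-IN-TREE rule; it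
supersedes the sextic part of the cell's standalone package file `HodgeCM/PerL34/GaloisB3Field.lean` (embedded
forms `rightStab_eq_fixingSubgroup_emb`, `no_quadratic_subfield_emb(')`, `card_fixingSubgroup_emb`,
`rightStab_eq_gal_emb`), with the right stabiliser of a ported 2001 file replaced by the tree's `IsPrimitive` /
`reflexLift` / fixed-field statements.

## Not here

The identification of CM types of `K` read in `L` with CM types valued in `ℂ`; abelian varieties.
-/

set_option autoImplicit false

namespace Literature.NumberTheory.ComplexMultiplication

open IntermediateField
open scoped Pointwise

section Sextic

variable {L : Type*} [Field L] [NumberField L] {K : Type*} [Field K] [NumberField K]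

/-- **Every CM type of a sextic field with `[L:ℚ] ∈ {24, 48}` is primitive** (field form; `c` a central involution
of `Gal(L/ℚ)` moving every embedding of `K`). [cite: Shimura1998, §8.2 Prop. 26] -/
theorem isPrimitive_of_sextic [IsGalois ℚ L] [IsNormalClosure ℚ K L]
    (hK : Module.finrank ℚ K = 6) (hL : Module.finrank ℚ L = 24 ∨ Module.finrank ℚ L = 48)
    (c : L ≃ₐ[ℚ] L) (hcen : ∀ g : L ≃ₐ[ℚ] L, c * g = g * c) (hc2 : c * c = 1)
    (hfix : ∀ φ : K →ₐ[ℚ] L, c • φ ≠ φ)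
    (Φ : Finset (K →ₐ[ℚ] L)) (hΦ : ∀ φ, φ ∈ Φ ↔ c • φ ∉ Φ) (ψ₀ : K →ₐ[ℚ] L) (h0 : ψ₀ ∈ Φ) :
    IsPrimitive (L ≃ₐ[ℚ] L) (↑Φ : Set (K →ₐ[ℚ] L)) ψ₀ := by
  classical
  have hX : Fintype.card (K →ₐ[ℚ] L) = 6 := by rw [card_algHom_eq_finrank K, hK]
  have hcard : Nat.card (L ≃ₐ[ℚ] L) = 24 ∨ Nat.card (L ≃ₐ[ℚ] L) = 48 := by
    rwa [IsGalois.card_aut_eq_finrank]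
  exact SexticB3.isPrimitive_of_card_of_central_involution hX hcard c hcen hc2 hfix Φ hΦ ψ₀ h0

/-- **`H' = H`** (field form): the stabiliser of the reflex lift `{g | g⁻¹ ∘ ψ₀ ∈ Φ}` is `Gal(L/ψ₀K)`.
[cite: Shimura1998, §8.2 Prop. 26] -/
theorem stabilizer_reflexLift_eq_fixingSubgroup_of_sextic [IsGalois ℚ L] [IsNormalClosure ℚ K L]
    (hK : Module.finrank ℚ K = 6) (hL : Module.finrank ℚ L = 24 ∨ Module.finrank ℚ L = 48)
    (c : L ≃ₐ[ℚ] L) (hcen : ∀ g : L ≃ₐ[ℚ] L, c * g = g * c) (hc2 : c * c = 1)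
    (hfix : ∀ φ : K →ₐ[ℚ] L, c • φ ≠ φ)
    (Φ : Finset (K →ₐ[ℚ] L)) (hΦ : ∀ φ, φ ∈ Φ ↔ c • φ ∉ Φ) (ψ₀ : K →ₐ[ℚ] L) (h0 : ψ₀ ∈ Φ) :
    MulAction.stabilizer (L ≃ₐ[ℚ] L) (reflexLift (↑Φ : Set (K →ₐ[ℚ] L)) ψ₀ : Set (L ≃ₐ[ℚ] L)) =
      ψ₀.fieldRange.fixingSubgroup := by
  rw [(isPrimitive_of_sextic hK hL c hcen hc2 hfix Φ hΦ ψ₀ h0).stabilizer_reflexLift_eq,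
    stabilizer_algHom_eq_fixingSubgroup]

/-- **`Kʳʳ = K`** (field form): the reflex field of the reflex type — the fixed field of `H'` — is `ψ₀(K)`.
[cite: Streng2010, Ch. I Lemma 7.2] -/
theorem fixedField_stabilizer_reflexLift_eq_of_sextic [IsGalois ℚ L] [IsNormalClosure ℚ K L]
    (hK : Module.finrank ℚ K = 6) (hL : Module.finrank ℚ L = 24 ∨ Module.finrank ℚ L = 48)
    (c : L ≃ₐ[ℚ] L) (hcen : ∀ g : L ≃ₐ[ℚ] L, c * g = g * c) (hc2 : c * c = 1)
    (hfix : ∀ φ : K →ₐ[ℚ] L, c • φ ≠ φ)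
    (Φ : Finset (K →ₐ[ℚ] L)) (hΦ : ∀ φ, φ ∈ Φ ↔ c • φ ∉ Φ) (ψ₀ : K →ₐ[ℚ] L) (h0 : ψ₀ ∈ Φ) :
    fixedField (MulAction.stabilizer (L ≃ₐ[ℚ] L) (reflexLift (↑Φ : Set (K →ₐ[ℚ] L)) ψ₀ : Set (L ≃ₐ[ℚ] L))) =
      ψ₀.fieldRange :=
  (isPrimitive_of_sextic hK hL c hcen hc2 hfix Φ hΦ ψ₀ h0).fixedField_stabilizer_reflexLift_eq

/-- **No quadratic subfield** (field form): no `E ⊆ ψ₀(K)` with `[E:ℚ] = 2` — in particular `K` contains no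
imaginary quadratic field. [folklore] -/
theorem no_quadratic_subfield_of_sextic [IsGalois ℚ L] [IsNormalClosure ℚ K L]
    (hK : Module.finrank ℚ K = 6) (hL : Module.finrank ℚ L = 24 ∨ Module.finrank ℚ L = 48)
    (c : L ≃ₐ[ℚ] L) (hcen : ∀ g : L ≃ₐ[ℚ] L, c * g = g * c) (hc2 : c * c = 1)
    (hfix : ∀ φ : K →ₐ[ℚ] L, c • φ ≠ φ) (ψ₀ : K →ₐ[ℚ] L) (E : IntermediateField ℚ L)
    (hEK : E ≤ ψ₀.fieldRange) (hE : Module.finrank ℚ E = 2) : False := by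
  classical
  have hX : Fintype.card (K →ₐ[ℚ] L) = 6 := by rw [card_algHom_eq_finrank K, hK]
  have hcard : Nat.card (L ≃ₐ[ℚ] L) = 24 ∨ Nat.card (L ≃ₐ[ℚ] L) = 48 := by
    rwa [IsGalois.card_aut_eq_finrank]
  refine SexticB3.no_index_two_above_stabilizer hX hcard c hcen hc2 hfix ψ₀ E.fixingSubgroup ?_ ?_
  · rw [stabilizer_algHom_eq_fixingSubgroup ψ₀]
    intro g hg
    rw [IntermediateField.mem_fixingSubgroup_iff] at hg ⊢
    exact fun x hx => hg x (hEK hx)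
  · have h1 : Nat.card E.fixingSubgroup = Module.finrank E L := by
      rw [← IsGalois.card_aut_eq_finrank E L]
      exact Nat.card_congr (IntermediateField.fixingSubgroupEquiv E).toEquiv
    have h2 : Module.finrank ℚ E * Module.finrank E L = Module.finrank ℚ L := Module.finrank_mul_finrank ℚ E L
    rw [h1, IsGalois.card_aut_eq_finrank, ← h2, hE]
    ring

/-- `|Gal(L/ψ₀K)| = [L:ℚ] / 6 ∈ {4, 8}`. [folklore] -/
theorem card_fixingSubgroup_of_sextic [IsGalois ℚ L]
    (hK : Module.finrank ℚ K = 6) (hL : Module.finrank ℚ L = 24 ∨ Module.finrank ℚ L = 48)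
    (ψ₀ : K →ₐ[ℚ] L) :
    Nat.card ψ₀.fieldRange.fixingSubgroup = 4 ∨ Nat.card ψ₀.fieldRange.fixingSubgroup = 8 := by
  have h1 : Nat.card ψ₀.fieldRange.fixingSubgroup = Module.finrank ψ₀.fieldRange L := by
    rw [← IsGalois.card_aut_eq_finrank ψ₀.fieldRange L]
    exact Nat.card_congr (IntermediateField.fixingSubgroupEquiv ψ₀.fieldRange).toEquiv
  have h2 : Module.finrank ℚ ψ₀.fieldRange * Module.finrank ψ₀.fieldRange L = Module.finrank ℚ L :=
    Module.finrank_mul_finrank ℚ ψ₀.fieldRange L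
  have h3 : Module.finrank ℚ ψ₀.fieldRange = 6 := by
    rw [← hK]
    exact ((AlgEquiv.ofInjectiveField ψ₀).toLinearEquiv.finrank_eq).symm
  rw [h1]
  rw [h3] at h2
  omega

end Sextic

/-! ### CM form: `c` = complex conjugation, all its properties derived -/

section SexticCM

open NumberField

variable {L : Type*} [Field L] [NumberField L] [IsCMField L] {K : Type*} [Field K] [NumberField K]
  [IsTotallyComplex K]

/-- **Every CM type of a sextic totally complex field `K` whose (CM) Galois closure `L` has degree `24` or `48` is
primitive** — `c := conjGal`, CM types `Φ ∋ ψ₀` with `φ ∈ Φ ↔ ρ ∘ φ ∉ Φ`. [cite: Dodson1984, §5.1.3 Prop. 1] -/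
theorem isPrimitive_of_sextic_cm [IsNormalClosure ℚ K L]
    (hK : Module.finrank ℚ K = 6) (hL : Module.finrank ℚ L = 24 ∨ Module.finrank ℚ L = 48)
    (Φ : Finset (K →ₐ[ℚ] L)) (hΦ : ∀ φ, φ ∈ Φ ↔ (conjGal : L ≃ₐ[ℚ] L) • φ ∉ Φ) (ψ₀ : K →ₐ[ℚ] L)
    (h0 : ψ₀ ∈ Φ) : IsPrimitive (L ≃ₐ[ℚ] L) (↑Φ : Set (K →ₐ[ℚ] L)) ψ₀ := by
  haveI := isGalois_of_isNormalClosure (L := L) K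
  exact isPrimitive_of_sextic hK hL conjGal conjGal_central conjGal_mul_conjGal conjGal_smul_ne Φ hΦ ψ₀ h0

/-- **`Kʳʳ = K`**, CM form: the reflex field of the reflex of `(K, Φ)` is `ψ₀(K)`. [cite: Streng2010, Ch. I Lemma 7.2] -/
theorem fixedField_stabilizer_reflexLift_eq_of_sextic_cm [IsNormalClosure ℚ K L]
    (hK : Module.finrank ℚ K = 6) (hL : Module.finrank ℚ L = 24 ∨ Module.finrank ℚ L = 48)
    (Φ : Finset (K →ₐ[ℚ] L)) (hΦ : ∀ φ, φ ∈ Φ ↔ (conjGal : L ≃ₐ[ℚ] L) • φ ∉ Φ) (ψ₀ : K →ₐ[ℚ] L)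
    (h0 : ψ₀ ∈ Φ) :
    haveI := isGalois_of_isNormalClosure (L := L) K
    fixedField (MulAction.stabilizer (L ≃ₐ[ℚ] L) (reflexLift (↑Φ : Set (K →ₐ[ℚ] L)) ψ₀ : Set (L ≃ₐ[ℚ] L))) =
      ψ₀.fieldRange := by
  haveI := isGalois_of_isNormalClosure (L := L) K
  exact fixedField_stabilizer_reflexLift_eq_of_sextic hK hL conjGal conjGal_central conjGal_mul_conjGal
    conjGal_smul_ne Φ hΦ ψ₀ h0

/-- **`H' = H`**, CM form: `Stab(reflex lift) = Gal(L/ψ₀K)`. [cite: Shimura1998, §8.2 Prop. 26] -/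
theorem stabilizer_reflexLift_eq_fixingSubgroup_of_sextic_cm [IsNormalClosure ℚ K L]
    (hK : Module.finrank ℚ K = 6) (hL : Module.finrank ℚ L = 24 ∨ Module.finrank ℚ L = 48)
    (Φ : Finset (K →ₐ[ℚ] L)) (hΦ : ∀ φ, φ ∈ Φ ↔ (conjGal : L ≃ₐ[ℚ] L) • φ ∉ Φ) (ψ₀ : K →ₐ[ℚ] L)
    (h0 : ψ₀ ∈ Φ) :
    MulAction.stabilizer (L ≃ₐ[ℚ] L) (reflexLift (↑Φ : Set (K →ₐ[ℚ] L)) ψ₀ : Set (L ≃ₐ[ℚ] L)) =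
      ψ₀.fieldRange.fixingSubgroup := by
  haveI := isGalois_of_isNormalClosure (L := L) K
  exact stabilizer_reflexLift_eq_fixingSubgroup_of_sextic hK hL conjGal conjGal_central conjGal_mul_conjGal
    conjGal_smul_ne Φ hΦ ψ₀ h0

/-- **No (imaginary) quadratic subfield**, CM form. [folklore] -/
theorem no_quadratic_subfield_of_sextic_cm [IsNormalClosure ℚ K L]
    (hK : Module.finrank ℚ K = 6) (hL : Module.finrank ℚ L = 24 ∨ Module.finrank ℚ L = 48)
    (ψ₀ : K →ₐ[ℚ] L) (E : IntermediateField ℚ L) (hEK : E ≤ ψ₀.fieldRange)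
    (hE : Module.finrank ℚ E = 2) : False := by
  haveI := isGalois_of_isNormalClosure (L := L) K
  exact no_quadratic_subfield_of_sextic hK hL conjGal conjGal_central conjGal_mul_conjGal conjGal_smul_ne ψ₀ E
    hEK hE

end SexticCM

end Literature.NumberTheory.ComplexMultiplication
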